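import Summits.QuantumFields.YangMills.Theorems.BalabanUVNodesN07AliasSumMarginSharpSmallL
import Summits.QuantumFields.YangMills.Theorems.BalabanUVNodesN07PointFeasibilityOneLevelSymbolBridge
import HarnessLib

/-!
# DAG node N07 [B11], road R0′ — the SHARP one-level margin for block side `L = 3`, displayed: «`K₀(θ) ≤ K(θ)`» in dag-n07-w7's letters, the
# raw display of `…OneLevelSymbolBridge` at `c₁ = 1`, and in x-space «`‖Δ⁻¹Q′ᴴβ‖² ≤ Re Σ_y conj β(y)(Δ⁻²Q′ᴴβ)(3y+1)`» on every torus with 3-blocks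

Cell `pub-ymgap` (HUMAN RULINGS D-0062 ∕ D-0149 ∕ D-0154), width seat `pub-ymgap-dag-n07-w5` g2, 2026-08-28.  `--kind proof --supports <K1 key>
--as helper` (count-neutral; CLAIM-3 cell bus 10:58Z, second file).  Dressing of `…AliasSumMarginSharpSmallL.aliasSum_margin_sharp_three` (the core
margin `(Π_κ sin(θ_κ∕2))·B(θ) ≤ 3^{|J|}·A(θ)`) in the three currencies of the lineage: dag-n07-w7's symbol letters (`matchedSymbol_le_aliasSymbolK` with
`π^{|J|}` replaced by `1`), the raw alias-sum display consumed by `…OneLevelSymbolBridge.symbolMargin_of_display` (per-coordinate constant `c₁ = 1`),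
and the x-space form on the torus `Tor (fine 3 M)` via p625080 ∕ p626779.

THE PRINT.  [B5] = T. Bałaban, CMP **95** (1984) 17–40 `[Balaban1984PropagatorsI]`, Sect. C p. 22 («Q′_kΔ⁻²Q′*_k»), (1.29)–(1.33) p. 23; [B6] = CMP **96**
(1984) 223–250 `[Balaban1984PropagatorsII]`, (2.22) p. 226; [I] = CMP **109** (1987) 249–301 `[Balaban1987RG1]`, (0.4) p. 253.  Context only; every
statement is [folklore] bookkeeping.

HONEST FRAMING (binding).  Count-neutral helper; the sharp constant is proved for `L = 3` ONLY (for `L ≥ 7` it is OPEN, `LOCATED-SHARP-CENTRE-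
DOMINANCE.md`); one averaging level; asserts NOTHING of [B11]∕[B6]∕[3]; `(P)_D` ∕ (L2)–(L4) OPEN; nothing consumed under road (a); `hker` ∕ stub 1 ∕
K0⁷ ∕ K1⁹ NOT closed; N07 NOT discharged; counts unmoved; no summit statement is proved by this seat — R4 closes the conditional finite-𝕋⁴ rung
`BalabanLadder.UV` only; nothing continuum ∕ ℝ⁴ ∕ OS ∕ mass gap ∕ Clay.  No `sorry`, no `def`, no `instance`, no `notation`.
-/

noncomputable section

open Finset

namespace Summit.QuantumFields.YangMills.Theorems.N07AliasSumMarginSharp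

open Literature.MathematicalPhysics.QuantumFieldTheory.Balaban1983to89
open Summit.QuantumFields.YangMills.Theorems.N07AliasSumPositivity
open Summit.QuantumFields.YangMills.Theorems.N07AliasSumMargin

/-! ## §3  «K₀(θ) ≤ K(θ)» for `L = 3` in the symbol letters, and the raw display at `c₁ = 1` -/

section Display

open Real

/-- The raw CENTRE display factorises through the core sum `A(θ) = Σ_m (Π_κ (−1)^{m_κ}∕s)∕(Σ_κ s²)²`:
`Σ_m (Π_κ f(θ_κ,m_κ))∕(Σ_κ Sxir n (θ_κ+2πm_κ))² = (Π_κ sin(θ_κ∕2)) · (n^{|J|})⁻¹ · (16n⁴)⁻¹ · A(θ)`, `f(θ,m) = sin((θ+2πm)∕2)∕(n s_m)`. [folklore] -/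
theorem rawCentre_eq_core {J : Type*} [Fintype J] [DecidableEq J] {n : ℕ} (hn : 0 < n) (θ : J → ℝ) :
    ∑ m : J → Fin n, (∏ κ, sin ((θ κ + 2 * π * (m κ : ℕ)) / 2) /
          ((n : ℝ) * sin ((θ κ + 2 * π * (m κ : ℕ)) / (2 * n)))) /
          (∑ κ, B4Strip.Sxir n (θ κ + 2 * π * (m κ : ℕ))) ^ 2
      = (∏ κ, sin (θ κ / 2)) * ((n : ℝ) ^ Fintype.card J)⁻¹ * (16 * (n : ℝ) ^ 4)⁻¹ *
          ∑ m : J → Fin n, (∏ κ, (-1 : ℝ) ^ (m κ : ℕ) / sin ((θ κ + 2 * π * (m κ : ℕ)) / (2 * n))) /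
            (∑ κ, sin ((θ κ + 2 * π * (m κ : ℕ)) / (2 * n)) ^ 2) ^ 2 := by
  have hn0 : (n : ℝ) ≠ 0 := by exact_mod_cast hn.ne'
  rw [Finset.mul_sum]
  refine Finset.sum_congr rfl fun m _ => ?_
  have hsin : ∀ κ, sin ((θ κ + 2 * π * (m κ : ℕ)) / 2) = (-1 : ℝ) ^ (m κ : ℕ) * sin (θ κ / 2) := by
    intro κ
    have e : (θ κ + 2 * π * (m κ : ℕ)) / 2 = θ κ / 2 + (m κ : ℕ) * π := by ring
    rw [e, Real.sin_add_nat_mul_pi]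
  simp_rw [hsin, B4Strip.Sxir_eq]
  have hnum : ∏ κ, (-1 : ℝ) ^ (m κ : ℕ) * sin (θ κ / 2) / ((n : ℝ) * sin ((θ κ + 2 * π * (m κ : ℕ)) / (2 * n)))
      = (∏ κ, sin (θ κ / 2)) * ((n : ℝ) ^ Fintype.card J)⁻¹ *
        ∏ κ, (-1 : ℝ) ^ (m κ : ℕ) / sin ((θ κ + 2 * π * (m κ : ℕ)) / (2 * n)) := by
    rw [← Finset.card_univ, ← Finset.prod_const, ← Finset.prod_inv_distrib, ← Finset.prod_mul_distrib,
      ← Finset.prod_mul_distrib]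
    exact Finset.prod_congr rfl (fun κ _ => by field_simp)
  rw [hnum, ← Finset.mul_sum]
  field_simp
  ring

/-- The raw MATCHED display factorises through the core sum `B(θ) = Σ_m (Π_κ s⁻²)∕(Σ_κ s²)²`:
`Σ_m (Π_κ f(θ_κ,m_κ)²)∕(Σ_κ Sxir n (θ_κ+2πm_κ))² = (Π_κ sin(θ_κ∕2))² · (n^{2|J|})⁻¹ · (16n⁴)⁻¹ · B(θ)`. [folklore] -/
theorem rawMatched_eq_core {J : Type*} [Fintype J] [DecidableEq J] {n : ℕ} (hn : 0 < n) (θ : J → ℝ) :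
    ∑ m : J → Fin n, (∏ κ, (sin ((θ κ + 2 * π * (m κ : ℕ)) / 2) /
          ((n : ℝ) * sin ((θ κ + 2 * π * (m κ : ℕ)) / (2 * n)))) ^ 2) /
          (∑ κ, B4Strip.Sxir n (θ κ + 2 * π * (m κ : ℕ))) ^ 2
      = (∏ κ, sin (θ κ / 2)) ^ 2 * ((n : ℝ) ^ (2 * Fintype.card J))⁻¹ * (16 * (n : ℝ) ^ 4)⁻¹ *
          ∑ m : J → Fin n, (∏ κ, (sin ((θ κ + 2 * π * (m κ : ℕ)) / (2 * n)) ^ 2)⁻¹) /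
            (∑ κ, sin ((θ κ + 2 * π * (m κ : ℕ)) / (2 * n)) ^ 2) ^ 2 := by
  have hn0 : (n : ℝ) ≠ 0 := by exact_mod_cast hn.ne'
  rw [Finset.mul_sum]
  refine Finset.sum_congr rfl fun m _ => ?_
  have hsin : ∀ κ, sin ((θ κ + 2 * π * (m κ : ℕ)) / 2) ^ 2 = sin (θ κ / 2) ^ 2 := by
    intro κ
    have e : (θ κ + 2 * π * (m κ : ℕ)) / 2 = θ κ / 2 + (m κ : ℕ) * π := by ring
    rw [e, Real.sin_add_nat_mul_pi, mul_pow, ← pow_mul, mul_comm (m κ : ℕ) 2, pow_mul]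
    norm_num
  simp_rw [div_pow, hsin, B4Strip.Sxir_eq, mul_pow]
  have hnum : ∏ κ, sin (θ κ / 2) ^ 2 / ((n : ℝ) ^ 2 * sin ((θ κ + 2 * π * (m κ : ℕ)) / (2 * n)) ^ 2)
      = (∏ κ, sin (θ κ / 2)) ^ 2 * ((n : ℝ) ^ (2 * Fintype.card J))⁻¹ *
        ∏ κ, (sin ((θ κ + 2 * π * (m κ : ℕ)) / (2 * n)) ^ 2)⁻¹ := by
    rw [← Finset.card_univ, pow_mul, ← Finset.prod_const, ← Finset.prod_pow, ← Finset.prod_inv_distrib,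
      ← Finset.prod_mul_distrib, ← Finset.prod_mul_distrib]
    exact Finset.prod_congr rfl (fun κ _ => by field_simp)
  rw [hnum, ← Finset.mul_sum]
  field_simp
  ring

/-- ★★★ **THE SHARP DISPLAY MARGIN FOR `L = 3`** in the raw shape of `…OneLevelSymbolBridge.symbolMargin_of_display` with per-coordinate constant
`c₁ = 1`: for every finite non-empty `J` and `θ ∈ (0,2π)^J`,
`1^{|J|} · Σ_m (Π_κ f(θ_κ,m_κ)²)∕(Σ_κ Sxir 3 (θ_κ+2πm_κ))² ≤ Σ_m (Π_κ f(θ_κ,m_κ))∕(Σ_κ Sxir 3 (θ_κ+2πm_κ))²`. [folklore] -/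
theorem displayMargin_sharp_three {n : ℕ} (hn3 : n = 3) (J : Type) [Fintype J] [DecidableEq J] [Nonempty J] (θ : J → ℝ)
    (hθ : ∀ κ, 0 < θ κ ∧ θ κ < 2 * π) :
    (1 : ℝ) ^ Fintype.card J * ∑ m : J → Fin n, (∏ κ, (sin ((θ κ + 2 * π * (m κ : ℕ)) / 2) /
          ((n : ℝ) * sin ((θ κ + 2 * π * (m κ : ℕ)) / (2 * n)))) ^ 2) /
          (∑ κ, B4Strip.Sxir n (θ κ + 2 * π * (m κ : ℕ))) ^ 2
      ≤ ∑ m : J → Fin n, (∏ κ, sin ((θ κ + 2 * π * (m κ : ℕ)) / 2) /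
          ((n : ℝ) * sin ((θ κ + 2 * π * (m κ : ℕ)) / (2 * n)))) /
          (∑ κ, B4Strip.Sxir n (θ κ + 2 * π * (m κ : ℕ))) ^ 2 := by
  have hn : 0 < n := by omega
  have hnR : (0 : ℝ) < n := by exact_mod_cast hn
  rw [one_pow, one_mul, rawCentre_eq_core hn θ, rawMatched_eq_core hn θ]
  have hcore := aliasSum_margin_sharp_three hn3 θ hθ
  have hP : 0 ≤ ∏ κ : J, sin (θ κ / 2) :=
    Finset.prod_nonneg (fun κ _ => (sin_pos_of_pos_of_lt_pi (by linarith [(hθ κ).1]) (by linarith [(hθ κ).2])).le)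
  set A := ∑ m : J → Fin n, (∏ κ, (-1 : ℝ) ^ (m κ : ℕ) / sin ((θ κ + 2 * π * (m κ : ℕ)) / (2 * n))) /
      (∑ κ, sin ((θ κ + 2 * π * (m κ : ℕ)) / (2 * n)) ^ 2) ^ 2 with hA
  set B := ∑ m : J → Fin n, (∏ κ, (sin ((θ κ + 2 * π * (m κ : ℕ)) / (2 * n)) ^ 2)⁻¹) /
      (∑ κ, sin ((θ κ + 2 * π * (m κ : ℕ)) / (2 * n)) ^ 2) ^ 2 with hB
  set P := ∏ κ : J, sin (θ κ / 2) with hPdef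
  -- multiply the core margin `P·B ≤ n^{|J|}·A` by `P · (n^{2|J|})⁻¹ · (16 n⁴)⁻¹ ≥ 0`
  have hfac : 0 ≤ P * ((n : ℝ) ^ (2 * Fintype.card J))⁻¹ * (16 * (n : ℝ) ^ 4)⁻¹ := by positivity
  have h := mul_le_mul_of_nonneg_left hcore hfac
  have e1 : P * ((n : ℝ) ^ (2 * Fintype.card J))⁻¹ * (16 * (n : ℝ) ^ 4)⁻¹ * (P * B)
      = P ^ 2 * ((n : ℝ) ^ (2 * Fintype.card J))⁻¹ * (16 * (n : ℝ) ^ 4)⁻¹ * B := by ring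
  have e2 : P * ((n : ℝ) ^ (2 * Fintype.card J))⁻¹ * (16 * (n : ℝ) ^ 4)⁻¹ * ((n : ℝ) ^ Fintype.card J * A)
      = P * ((n : ℝ) ^ Fintype.card J)⁻¹ * (16 * (n : ℝ) ^ 4)⁻¹ * A := by
    have hx : ((n : ℝ) ^ Fintype.card J)⁻¹ * (n : ℝ) ^ Fintype.card J = 1 := inv_mul_cancel₀ (by positivity)
    rw [pow_mul', sq, mul_inv]
    linear_combination (P * (16 * (n : ℝ) ^ 4)⁻¹ * A * ((n : ℝ) ^ Fintype.card J)⁻¹) * hx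
  rw [e1, e2] at h
  exact h

/-- ★★ **«`K₀(θ) ≤ K(θ)`» for `L = 3` in dag-n07-w7's letters** (`matchedSymbol_le_aliasSymbolK` with `π^{|J|}` replaced by ONE):
`L^{−2|J|} Σ_m Π_κ [sin²(θ_κ∕2)∕s²]·(4Σs²)^{−2} ≤ L^{−|J|} Σ_m Π_κ [(−1)^{m_κ} sin(θ_κ∕2)∕s]·(4Σs²)^{−2}`, `L = 3`. [folklore] -/
theorem matchedSymbol_le_aliasSymbolK_sharp_three {J : Type*} [Fintype J] [DecidableEq J] {L : ℕ} (hL3 : L = 3)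
    (θ : J → ℝ) (hθ : ∀ κ, 0 < θ κ ∧ θ κ < 2 * π) :
    ((L : ℝ) ^ (2 * Fintype.card J))⁻¹ * ∑ m : J → Fin L,
        (∏ κ, sin (θ κ / 2) ^ 2 / sin ((θ κ + 2 * π * (m κ : ℕ)) / (2 * L)) ^ 2) /
          (4 * ∑ κ, sin ((θ κ + 2 * π * (m κ : ℕ)) / (2 * L)) ^ 2) ^ 2
      ≤ ((L : ℝ) ^ Fintype.card J)⁻¹ * ∑ m : J → Fin L,
        (∏ κ, (-1 : ℝ) ^ (m κ : ℕ) * sin (θ κ / 2) / sin ((θ κ + 2 * π * (m κ : ℕ)) / (2 * L))) /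
          (4 * ∑ κ, sin ((θ κ + 2 * π * (m κ : ℕ)) / (2 * L)) ^ 2) ^ 2 := by
  have hLpos : (0 : ℝ) < L := by subst hL3; norm_num
  have keyB : ∀ m : J → Fin L,
      (∏ κ, sin (θ κ / 2) ^ 2 / sin ((θ κ + 2 * π * (m κ : ℕ)) / (2 * L)) ^ 2) /
        (4 * ∑ κ, sin ((θ κ + 2 * π * (m κ : ℕ)) / (2 * L)) ^ 2) ^ 2 =
      ((∏ κ : J, sin (θ κ / 2)) * (∏ κ : J, sin (θ κ / 2)) / 16) *
        ((∏ κ, (sin ((θ κ + 2 * π * (m κ : ℕ)) / (2 * L)) ^ 2)⁻¹) /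
          (∑ κ, sin ((θ κ + 2 * π * (m κ : ℕ)) / (2 * L)) ^ 2) ^ 2) := by
    intro m
    have e : (∏ κ, sin (θ κ / 2) ^ 2 / sin ((θ κ + 2 * π * (m κ : ℕ)) / (2 * L)) ^ 2)
        = (∏ κ : J, sin (θ κ / 2)) * (∏ κ : J, sin (θ κ / 2)) *
          ∏ κ, (sin ((θ κ + 2 * π * (m κ : ℕ)) / (2 * L)) ^ 2)⁻¹ := by
      rw [← Finset.prod_mul_distrib, ← Finset.prod_mul_distrib]
      exact Finset.prod_congr rfl (fun κ _ => by rw [div_eq_mul_inv, sq])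
    rw [e]
    ring
  have keyA : ∀ m : J → Fin L,
      (∏ κ, (-1 : ℝ) ^ (m κ : ℕ) * sin (θ κ / 2) / sin ((θ κ + 2 * π * (m κ : ℕ)) / (2 * L))) /
        (4 * ∑ κ, sin ((θ κ + 2 * π * (m κ : ℕ)) / (2 * L)) ^ 2) ^ 2 =
      ((∏ κ : J, sin (θ κ / 2)) / 16) *
        ((∏ κ, (-1 : ℝ) ^ (m κ : ℕ) / sin ((θ κ + 2 * π * (m κ : ℕ)) / (2 * L))) /
          (∑ κ, sin ((θ κ + 2 * π * (m κ : ℕ)) / (2 * L)) ^ 2) ^ 2) := by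
    intro m
    have e : (∏ κ, (-1 : ℝ) ^ (m κ : ℕ) * sin (θ κ / 2) / sin ((θ κ + 2 * π * (m κ : ℕ)) / (2 * L)))
        = (∏ κ : J, sin (θ κ / 2)) *
          ∏ κ, (-1 : ℝ) ^ (m κ : ℕ) / sin ((θ κ + 2 * π * (m κ : ℕ)) / (2 * L)) := by
      rw [← Finset.prod_mul_distrib]
      exact Finset.prod_congr rfl (fun κ _ => by ring)
    rw [e]
    ring
  simp only [keyB, keyA, ← Finset.mul_sum]
  have hmar := aliasSum_margin_sharp_three hL3 θ hθ
  set A := ∑ m : J → Fin L,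
    (∏ κ, (-1 : ℝ) ^ (m κ : ℕ) / sin ((θ κ + 2 * π * (m κ : ℕ)) / (2 * L))) /
      (∑ κ, sin ((θ κ + 2 * π * (m κ : ℕ)) / (2 * L)) ^ 2) ^ 2 with hA
  set B := ∑ m : J → Fin L, (∏ κ, (sin ((θ κ + 2 * π * (m κ : ℕ)) / (2 * L)) ^ 2)⁻¹) /
      (∑ κ, sin ((θ κ + 2 * π * (m κ : ℕ)) / (2 * L)) ^ 2) ^ 2 with hB
  set P := ∏ κ : J, sin (θ κ / 2) with hP
  have hPnn : 0 ≤ P :=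
    Finset.prod_nonneg (fun κ _ => (sin_pos_of_pos_of_lt_pi (by linarith [(hθ κ).1]) (by linarith [(hθ κ).2])).le)
  have hLJ : (0 : ℝ) < (L : ℝ) ^ Fintype.card J := by positivity
  have h1 : ((L : ℝ) ^ (2 * Fintype.card J))⁻¹ * (P * P / 16 * B)
      = (P / 16 * ((L : ℝ) ^ (2 * Fintype.card J))⁻¹) * (P * B) := by ring
  have h2 : ((L : ℝ) ^ Fintype.card J)⁻¹ * (P / 16 * A)
      = (P / 16 * ((L : ℝ) ^ (2 * Fintype.card J))⁻¹) * ((L : ℝ) ^ Fintype.card J * A) := by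
    have hx : ((L : ℝ) ^ Fintype.card J)⁻¹ * (L : ℝ) ^ Fintype.card J = 1 := inv_mul_cancel₀ hLJ.ne'
    rw [pow_mul', sq, mul_inv]
    linear_combination (-(P / 16 * A * ((L : ℝ) ^ Fintype.card J)⁻¹)) * hx
  rw [h1, h2]
  exact mul_le_mul_of_nonneg_left hmar (by positivity)

end Display

/-! ## §4  In x-space: the centre form dominates the matched form with constant ONE on every torus with 3-blocks -/

section XSpace

open scoped Matrix ComplexConjugate
open B5Prop11Plancherel (Tor fine)
open B5Block118 (bpt QsOp)
open B5LaplaceInverse (LapSinv)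
open Summit.QuantumFields.YangMills.BalabanUVNodes.N07PointFeasibilityOneLevel (norm_sq_lapInv_le_centreForm_of_display)

/-- ★★★ **THE SHARP ONE-LEVEL MARGIN IN x-SPACE, BLOCK SIDE 3**: on the torus `Tor (fine 3 M)` of any dimension `d` and any coarse size `M`,
for EVERY block function `β`, `‖Δ⁻¹Q′ᴴβ‖² ≤ Re Σ_y conj β(y)·(Δ⁻²Q′ᴴβ)(3y + 1)` — the matched form `⟨β, Q′Δ⁻²Q′ᴴβ⟩` ([B5] Sect. C, [B6] (2.22)) is
dominated by the CENTRE form (centre `c₀ = 1` of the 3-block) with constant ONE, uniformly in the torus (p625080's transfer ∘ p626779's bridge ∘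
`displayMargin_sharp_three`). [cite: Balaban1984PropagatorsI, Sect. C p.22, (1.30)–(1.33) p.23; Balaban1987RG1, (0.4) p.253] -/
theorem norm_sq_lapInv_le_centreForm_sharp_three {d : ℕ} (M : Fin d → ℕ) [∀ μ, NeZero (M μ)] (β : Tor M → ℂ) :
    ∑ x, ‖(LapSinv (fine 3 M) ((3 : ℕ) : ℂ) *ᵥ ((QsOp 3 M)ᴴ *ᵥ β)) x‖ ^ 2 ≤
      (star β ⬝ᵥ (fun y => (LapSinv (fine 3 M) ((3 : ℕ) : ℂ) *ᵥ (LapSinv (fine 3 M) ((3 : ℕ) : ℂ) *ᵥ ((QsOp 3 M)ᴴ *ᵥ β)))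
        (bpt 3 M y (fun _ => (1 : Fin 3))))).re := by
  have h := norm_sq_lapInv_le_centreForm_of_display 3 M (fun _ => (1 : Fin 3)) (fun _ => rfl) (c₁ := 1) zero_le_one le_rfl
    (fun J _ _ _ θ hθ => displayMargin_sharp_three rfl J θ hθ) β
  rwa [one_pow, one_mul] at h

end XSpace

end Summit.QuantumFields.YangMills.Theorems.N07AliasSumMarginSharp

end
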